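import Summits.AtomisticToContinuum.HydrodynamicLimit.Theorems.CollisionIsometryCLTCollisionalTransferLocalityObsLLN
import Summits.AtomisticToContinuum.HydrodynamicLimit.Theorems.CollisionIsometryCLTCollisionalTransferLocalityBalanceIdentity
import Summits.AtomisticToContinuum.HydrodynamicLimit.Theorems.JParityClosureOddContactSymmetryGibbsInvariance
import HarnessLib

/-!
# The `Cc` side of the equilibrium rung of the crux (line `hemisphere-affine-slaving`)

Helper file (`--supports stmt-AtomisticToContinuum-9518`, line `hemisphere-affine-slaving`, skeleton
v10.1, stub `cc_tendsto_zero_of_timeIntegral_const`) for the crux `CollisionalTransferLocality`.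
Under the HOMOGENEOUS local Gibbs law (activity `1`, mean velocity `0`, temperature `θ > 0`) the
crux's residual

  `Cc(τ) = O(τ, Φ_τ z) − O(0, Φ_0 z) − I_N(z, τ)`,
  `I_N(z, τ) = ∫₀^τ [O_{∂ψ,∂χ}(s, Φ_s z) + d/dr O(s, freeFlight_r Φ_s z)|_{r=0}] ds`,

tends to `0` in probability at every fixed `τ ∈ [0, t]`, GIVEN that the time integral `I_N`
concentrates at `(3θ/2)(∫ χ_τ − ∫ χ_0)` (the hypothesis `hInt`, which is the neighbouring stub
`cc_timeIntegral_tendsto_const`). This file is the assembly: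

* `Cc(τ) = [O(τ, Φ_τ z) − ℓ_τ] − [O(0, Φ_0 z) − ℓ_0] − [I_N − (ℓ_τ − ℓ_0)]`, `ℓ_s = (3θ/2) ∫ χ_s`
  (pure algebra, `cc_eq_three_parts`);
* each one-time term is small in probability: the event `{η < |O(s, Φ_s z) − ℓ_s|}` is the preimage
  under `Φ_s` of the static event `{η < |O(s, w) − ℓ_s|}`, the homogeneous law is STATIONARY under
  every hard-sphere flow (`map_flow_localGibbsLaw_const`, so `G_N(Φ_s⁻¹ A) ≤ (Φ_s)_# G_N (A) = G_N A`,
  `Measure.le_map_apply` — no measurability of `A` is needed), and `G_N A → 0` is the static law of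
  large numbers for the observable (`obs_lln_const`, Maxwellian velocities: `E vⱼ = 0`,
  `E|v|²/2 = 3θ/2`) — this is `obs_flow_lln_const`;
* union bound at levels `δ/3` (`obsLLN_tendsto_measure_lt_abs_add`).

Everything is folklore probability; nothing is cited.
-/

namespace Summit.AtomisticToContinuum.HydrodynamicLimit.Theorems.HemisphereAffineSlaving

open scoped BigOperators Topology Classical ENNReal InnerProductSpace
open Filter Set Function MeasureTheory

noncomputable section

open Literature.MathematicalPhysics.KineticTheory (T3 V3)
open Literature.MathematicalPhysics.KineticTheory (localGibbsLaw empiricalDensityField)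

/-! ### Algebra: the three-part splitting of the residual -/

/-- The crux's residual split into the two one-time terms and the time-integral term, each
centred at its limit: `Cc(τ) = [O(τ) − ℓ_τ] + (−[O(0) − ℓ_0]) + (−[I_N − (ℓ_τ − ℓ_0)])` with
`ℓ_s = (3θ/2) ∫ χ_s` (the inner empirical integral of `Cc` is `Obs (∂ₛψ) (∂ₛχ)` by `rfl`).
[folklore] -/
theorem cc_eq_three_parts (θ σ : ℝ) (Φ : Flows σ) (ψ : ℝ → T3 → V3) (χ : ℝ → T3 → ℝ) (N : ℕ)
    (z : Cfg N) (τ : ℝ) :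
    Cc σ Φ ψ χ N z τ =
      (Obs ψ χ N τ ((Φ N).flow τ z) - 3 * θ / 2 * ∫ x, χ τ x) +
        -(Obs ψ χ N 0 ((Φ N).flow 0 z) - 3 * θ / 2 * ∫ x, χ 0 x) +
        -((∫ s in Icc 0 τ, (Obs (Literature.Analysis.FunctionSpaces.Torus.timeDeriv ψ)
            (Literature.Analysis.FunctionSpaces.Torus.timeDeriv χ) N s ((Φ N).flow s z) +
            deriv (fun r : ℝ => Obs ψ χ N s (Literature.Analysis.FluidPDE.freeFlight
              (Literature.Analysis.FluidPDE.Torus.geometry (Fin 3)) r ((Φ N).flow s z))) 0)) -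
          3 * θ / 2 * ((∫ x, χ τ x) - ∫ x, χ 0 x)) := by
  unfold Cc Obs
  ring

/-! ### One-time terms: stationarity + the static law of large numbers -/

/-- **One-time law of large numbers along the flow at equilibrium.** Under the homogeneous local
Gibbs laws (probability measures whose empirical density field satisfies its law of large numbers),
for continuous slices `ψ_s`, `χ_s` and `η > 0`,
`G_N(η < |O(s, Φ_s z) − (3θ/2) ∫ χ_s|) → 0`: the event is the `Φ_s`-preimage of a static event,
the homogeneous law is invariant under the flow (`map_flow_localGibbsLaw_const`), and the static
event is small by `obs_lln_const`. [folklore] -/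
theorem obs_flow_lln_const {σ θ : ℝ} (hθ : 0 < θ) (Φ : Flows σ)
    (hP : ∀ N, IsProbabilityMeasure (localGibbsLaw σ (fun _ => 1) (fun _ => 0) (fun _ => θ) N (Φ N)))
    (hL : ∀ f : T3 → ℝ, Continuous f → ∀ δ : ℝ, 0 < δ → Tendsto (fun N : ℕ =>
      localGibbsLaw σ (fun _ => 1) (fun _ => 0) (fun _ => θ) N (Φ N)
        {z | δ < |empiricalDensityField z f - ∫ x, f x|}) atTop (𝓝 0))
    {ψ : ℝ → T3 → V3} {χ : ℝ → T3 → ℝ} {s : ℝ} (hψs : Continuous (ψ s))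
    (hχs : Continuous (χ s)) {η : ℝ} (hη : 0 < η) :
    Tendsto (fun N : ℕ => localGibbsLaw σ (fun _ => 1) (fun _ => 0) (fun _ => θ) N (Φ N)
      {z | η < |Obs ψ χ N s ((Φ N).flow s z) - 3 * θ / 2 * ∫ x, χ s x|}) atTop (𝓝 0) := by
  refine tendsto_of_tendsto_of_tendsto_of_le_of_le tendsto_const_nhds
    (obs_lln_const hθ Φ hP hL (ψ s) (χ s) hψs hχs η hη) (fun N => zero_le) (fun N => ?_)
  calc localGibbsLaw σ (fun _ => 1) (fun _ => 0) (fun _ => θ) N (Φ N)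
        {z | η < |Obs ψ χ N s ((Φ N).flow s z) - 3 * θ / 2 * ∫ x, χ s x|}
      ≤ (localGibbsLaw σ (fun _ => 1) (fun _ => 0) (fun _ => θ) N (Φ N)).map ((Φ N).flow s)
          {w | η < |Obs ψ χ N s w - 3 * θ / 2 * ∫ x, χ s x|} :=
        Measure.le_map_apply ((Φ N).measurable_flow s).aemeasurable _
    _ = localGibbsLaw σ (fun _ => 1) (fun _ => 0) (fun _ => θ) N (Φ N)
          {w | η < |Obs ψ χ N s w - 3 * θ / 2 * ∫ x, χ s x|} := by
        rw [map_flow_localGibbsLaw_const]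
    _ = _ := by simp only [BalanceIdentity.Obs_eq_sum]

/-! ### The registered stub -/

/-- **Registered stub `cc_tendsto_zero_of_timeIntegral_const`** of crux stmt-AtomisticToContinuum-9518
(line hemisphere-affine-slaving, equilibrium rung, `Cc` side). Under the homogeneous local Gibbs
law at temperature `θ > 0` (probability measures, density law of large numbers), for smooth
space–time tests `ψ, χ` on `[0, t]`: IF the time-integral part of the residual concentrates at
`(3θ/2)(∫ χ_τ − ∫ χ_0)` for every `τ ∈ [0, t]`, THEN `Cc(τ) → 0` in probability for every
`τ ∈ [0, t]` — the two one-time terms concentrate at `(3θ/2) ∫ χ_τ` and `(3θ/2) ∫ χ_0` by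
stationarity and the static law of large numbers (`obs_flow_lln_const`), and the three pieces are
assembled by the union bound at levels `δ/3`. [folklore] -/
theorem cc_tendsto_zero_of_timeIntegral_const : ∀ {σ θ : ℝ}, 0 < θ → ∀ (Φ : Flows σ), (∀ N, IsProbabilityMeasure (Literature.MathematicalPhysics.KineticTheory.localGibbsLaw σ (fun _ => 1) (fun _ => 0) (fun _ => θ) N (Φ N))) → (∀ f : T3 → ℝ, Continuous f → ∀ δ : ℝ, 0 < δ → Tendsto (fun N : ℕ => Literature.MathematicalPhysics.KineticTheory.localGibbsLaw σ (fun _ => 1) (fun _ => 0) (fun _ => θ) N (Φ N) {z | δ < |Literature.MathematicalPhysics.KineticTheory.empiricalDensityField z f - ∫ x, f x|}) atTop (𝓝 0)) → ∀ {t : ℝ}, 0 < t → ∀ {ψ : ℝ → T3 → V3} {χ : ℝ → T3 → ℝ}, Literature.Analysis.FunctionSpaces.Torus.IsSmoothSpaceTimeOn (Icc 0 t) ψ → Literature.Analysis.FunctionSpaces.Torus.IsSmoothSpaceTimeOn (Icc 0 t) χ → (∀ τ ∈ Icc 0 t, ∀ δ : ℝ, 0 < δ → Tendsto (fun N : ℕ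 => Literature.MathematicalPhysics.KineticTheory.localGibbsLaw σ (fun _ => 1) (fun _ => 0) (fun _ => θ) N (Φ N) {z | δ < |(∫ s in Icc 0 τ, (Obs (Literature.Analysis.FunctionSpaces.Torus.timeDeriv ψ) (Literature.Analysis.FunctionSpaces.Torus.timeDeriv χ) N s ((Φ N).flow s z) + deriv (fun r : ℝ => Obs ψ χ N s (Literature.Analysis.FluidPDE.freeFlight (Literature.Analysis.FluidPDE.Torus.geometry (Fin 3)) r ((Φ N).flow s z))) 0)) - 3 * θ / 2 * ((∫ x, χ τ x) - ∫ x, χ 0 x)|}) atTop (𝓝 0)) → ∀ τ ∈ Icc 0 t, ∀ δ : ℝ, 0 < δ → Tendsto (fun N : ℕ => Literature.MathematicalPhysics.KineticTheory.localGibbsLaw σ (fun _ => 1) (fun _ => 0) (fun _ => θ) N (Φ N) {z | δ < |Cc σ Φ ψ χ N z τ|}) atTop (𝓝 0) := by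
  intro σ θ hθ Φ hP hL t ht ψ χ hψ hχ hInt τ hτ δ hδ
  have hδ3 : 0 < δ / 3 := by positivity
  have h0 : (0 : ℝ) ∈ Icc 0 t := ⟨le_rfl, ht.le⟩
  -- (i) the time-`τ` term
  have hA := obs_flow_lln_const hθ Φ hP hL (s := τ) (hψ.isSmooth_slice hτ).continuous
    (hχ.isSmooth_slice hτ).continuous hδ3
  -- (ii) the time-`0` term
  have hB : Tendsto (fun N : ℕ => localGibbsLaw σ (fun _ => 1) (fun _ => 0) (fun _ => θ) N (Φ N)
      {z | δ / 3 < |-(Obs ψ χ N 0 ((Φ N).flow 0 z) - 3 * θ / 2 * ∫ x, χ 0 x)|}) atTop (𝓝 0) := by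
    simpa only [abs_neg] using obs_flow_lln_const hθ Φ hP hL (s := 0)
      (hψ.isSmooth_slice h0).continuous (hχ.isSmooth_slice h0).continuous hδ3
  -- (iii) the time-integral term (the hypothesis)
  have hC : Tendsto (fun N : ℕ => localGibbsLaw σ (fun _ => 1) (fun _ => 0) (fun _ => θ) N (Φ N)
      {z | δ / 3 < |-((∫ s in Icc 0 τ, (Obs (Literature.Analysis.FunctionSpaces.Torus.timeDeriv ψ)
          (Literature.Analysis.FunctionSpaces.Torus.timeDeriv χ) N s ((Φ N).flow s z) +
          deriv (fun r : ℝ => Obs ψ χ N s (Literature.Analysis.FluidPDE.freeFlight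
            (Literature.Analysis.FluidPDE.Torus.geometry (Fin 3)) r ((Φ N).flow s z))) 0)) -
        3 * θ / 2 * ((∫ x, χ τ x) - ∫ x, χ 0 x))|}) atTop (𝓝 0) := by
    simpa only [abs_neg] using hInt τ hτ (δ / 3) hδ3
  -- assembly: union bound at levels `δ / 3`
  have hall := obsLLN_tendsto_measure_lt_abs_add (obsLLN_tendsto_measure_lt_abs_add hA hB) hC
  refine tendsto_of_tendsto_of_tendsto_of_le_of_le tendsto_const_nhds hall (fun N => zero_le)
    (fun N => measure_mono fun z hz => ?_)
  simp only [Set.mem_setOf_eq] at hz ⊢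
  calc δ / 3 + δ / 3 + δ / 3 = δ := by ring
    _ < |Cc σ Φ ψ χ N z τ| := hz
    _ = _ := by rw [cc_eq_three_parts θ σ Φ ψ χ N z τ]

end

end Summit.AtomisticToContinuum.HydrodynamicLimit.Theorems.HemisphereAffineSlaving
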